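/-
Copyright (c) 2026 the pub-hodgecm-mathlib formalisation cell (harness21).  Prover seat hodgecm-mathlib-LA1-p04 (g3) (drafter; the (ν8)-series author of record is LA3-p01),
«GO 500» half A, L3 ROOF road (socket `stub_FROB` → `stub_ROOF0`), RULING (K-ROWS) ∕ (γ1) «ONE REDUCTION IN THE CELL» (LA3-plan (g2) 2026-09-02T06:19:23Z, 06:22:53Z); 2026-09-02.
-/
import Literature.AlgebraicGeometry.AbelianSchemes.AbelianSchemeHomReductionSpecialFibreModel
import Literature.AlgebraicGeometry.AbelianSchemes.AbelianSchemeHomReductionSpecialFibreKernelBound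
import HarnessLib

/-!
# REDUCTION OF A HOMOMORPHISM BETWEEN FIBRE TUPLES — ONE PRODUCING HEAD WITH ALL KERNEL ROWS
# ((i)–(iv) of ★ (ν8), (iv-h) of ★ (ν8h), (v-b)∕(v-a) along the valuation-ring model of ★ (ν8R), and the one-sided ideal bound (K2) of ★ (ν8k-b); [SerreTate1968] §1)

Topic `AlgebraicGeometry/AbelianSchemes`, namespace `Literature.AlgebraicGeometry.AbelianSchemes.AbelianSchemeOver`.  THEOREMS ONLY (no definition, no named fact, no
`instance`, no notation, no `sorry`).  Cell `hodgecm-mathlib` (D-0151), F0∕P6 «MOD», «GO 500» half A line L3, RULING (γ1) «ONE ∃, ONE ROOF DOWNSTAIRS»: every kernel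
fact about THE reduced leg `q̄` must leave the `∃` as a ROW of the ONE producing head.  This file is that head: **`exists_specialFibre_hom_reduction_kerRows`** = the binders
and rows (i) (ii) (iii) (iv) (iv-h) of ★ (ν8h) `exists_specialFibre_hom_reduction_comp` VERBATIM, with ONE extra binder `(act : 𝒜.RingAction 𝒪)` (as ★ (ν8k-b)), PLUS the
rows (v-b-model) (v-a-model) of ★ (ν8R) `exists_specialFibre_hom_reduction_model` VERBATIM (KILL ∕ kernel CLAUSE along a flat `𝒦 ↪ 𝒜_x̃`, `x̃` the `R = 𝒪_Ω̄`-point extending `x`,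
three-piece isomorphisms explicit) = (K3), PLUS the row (K2) of ★ (ν8k-b) `exists_specialFibre_hom_reduction_comp_kerBound` VERBATIM (`Ker u ⊆ 𝒜_x[𝔞] ⇒ Ker ū ⊆ 𝒜_{x̄}[𝔞]` on
all `T`-points, every ideal `𝔞`).  NO new mathematics: ONE ★ (ν7) turnkey, then ★ (ν8R) `specialFibre_transfers_of_generic_model` (six transfers at once), ★ (ν8h) §1 and
★ (ν8k-b) §2 at the SAME stage data — so all eight rows speak about the same `ū`.
Consumers: ★ organ #3-bis ED. 2 ∕ the ROOF-LEGS leaflet ((K1)(K2)(K3) for `q̄`), (ρ1)-rebased `redHom_spGeoOf_of_legs` (LA1-p02), the (rL-asm) `hker` (LA1-p03).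

HONEST LABEL: HC_CM is proved only modulo the cell's 2 remaining named inputs (hLiu418 24832, h413 24833) until rung 0 closes; generic capital on
`--supports stmt-HodgeConjecture-24832`, pays no letter.

## References
* [SerreTate1968] J.-P. Serre, J. Tate, *Good reduction of abelian varieties*, Ann. of Math. 88 (1968), §1 (Lemma 2, Theorem 1).
* [BoschLutkebohmertRaynaud1990] S. Bosch, W. Lütkebohmert, M. Raynaud, *Néron Models* (1990), §1.2 Prop. 8, §7.1 Lemma 5 ∕ Prop. 6, §7.3 Prop. 6 (p. 180).
* [MumfordFogartyKirwan1994] D. Mumford, J. Fogarty, F. Kirwan, *GIT*, 3rd ed., Ch. 6 §1 Cor. 6.2 (p. 116), Ch. 7 §2 Def. 7.1–7.2 (p. 129).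
* [MumfordAV1970] D. Mumford, *Abelian Varieties* (1970), §15 Thm. 1 (p. 143).
* [Hartshorne1977] R. Hartshorne, *Algebraic Geometry*, II.4.7 (valuative criterion).
-/

set_option autoImplicit false

noncomputable section

set_option backward.isDefEq.respectTransparency false

open CategoryTheory CategoryTheory.Limits AlgebraicGeometry MonoidalCategory CartesianMonoidalCategory
open scoped MonObj CategoryTheory.Obj NumberField
open Literature.AlgebraicGeometry.Motives
open IsDedekindDomain IsDedekindDomain.HeightOneSpectrum ValuativeRel
open Literature.NumberTheory.EllipticCurves (genericFibre specGenericPoint)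
open Literature.NumberTheory.GaloisRepresentations (closureValuationSubring)
open Literature.NumberTheory.DiophantineGeometry
open Literature.AlgebraicGeometry.GroupSchemes.GroupSchemeKernel (ker)

namespace Literature.AlgebraicGeometry.AbelianSchemes

namespace AbelianSchemeOver

universe u

section Head

variable {K : Type} [Field K] [NumberField K] {v : HeightOneSpectrum (𝓞 K)} {Y : SchemeOver K}
  (𝓨 : IntegralModel (valuationSubringAtPrime K v) K Y) [IsProper 𝓨.total.hom]
  (𝒜 𝒞 : AbelianSchemeOver 𝓨.total.left) (x x'' : AlgPoints Y (AlgebraicClosure (v.adicCompletion K)))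

set_option maxHeartbeats 800000 in -- = ★ (ν8h) p849598's budget for the same turnkey `obtain` (400 000 times out at `whnf`, measured on ★ (ν8k-b)); each row is one `exact`
/-- **THE SPECIAL FIBRE OF THE REDUCTION OF A HOMOMORPHISM BETWEEN FIBRE TUPLES — ALL KERNEL ROWS FROM ONE TURNKEY.**  Binders and rows (i) (ii) (iii) (iv) (iv-h) = ★ (ν8h)
`exists_specialFibre_hom_reduction_comp` verbatim, plus `(act : 𝒜.RingAction 𝒪)`; rows (v-b-model) (v-a-model) = ★ (ν8R) `exists_specialFibre_hom_reduction_model` verbatim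
(`R := 𝒪_Ω̄`, `x̃ := extendPoint …`, flat `𝒦 ↪ 𝒜_x̃`, read upstairs∕downstairs through the explicit three-piece isomorphisms of ★ (d5)); row (K2) = ★ (ν8k-b) (v-b) verbatim
(`IsFinite u → Surjective u → ∀ 𝔞, (Ker u ⊆ 𝒜_x[𝔞] on T-points) → (Ker ū ⊆ 𝒜_{x̄}[𝔞] on T-points)`).  All eight rows for THE SAME `ū`.
[cite: SerreTate1968, §1 Lemma 2 and Theorem 1] [cite: BoschLutkebohmertRaynaud1990, §1.2 Prop. 8, §7.1 Prop. 6 and §7.3 Prop. 6 (p. 180)]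
[cite: MumfordFogartyKirwan1994, Ch. 6 §1 Corollary 6.2 (p. 116); Ch. 7 §2 Definition 7.2 (p. 129)] [cite: MumfordAV1970, §15 Thm. 1 (p. 143)] [cite: Hartshorne1977, II.4.7] -/
theorem exists_specialFibre_hom_reduction_kerRows
    (u : ((𝒜.baseChange (𝓨.genericIso'.inv.left ≫ pullback.fst 𝓨.total.hom (specGenericPoint (valuationSubringAtPrime K v) K))).baseChange x.left).X ⟶
         ((𝒞.baseChange (𝓨.genericIso'.inv.left ≫ pullback.fst 𝓨.total.hom (specGenericPoint (valuationSubringAtPrime K v) K))).baseChange x''.left).X)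
    [IsMonHom u]
    -- (ν8k-b) extra datum: an `𝒪`-action on `𝒜` (no Serre presentation is asked)
    {O : Type} [CommRing O] (act : 𝒜.RingAction O) :
    ∃ (ubar : ((𝒜.baseChange (pullback.fst 𝓨.total.hom (specResidueField v))).baseChange (𝓨.geomReductionMap x).left).X ⟶
               ((𝒞.baseChange (pullback.fst 𝓨.total.hom (specResidueField v))).baseChange (𝓨.geomReductionMap x'').left).X) (_ : IsMonHom ubar),
      -- (i) finite surjective ⇒ flat surjective
      (IsFinite u.left → Surjective u.left → Flat ubar.left ∧ Function.Surjective ubar.left.base) ∧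
      -- (ii) equivariance for endomorphism pairs transfers
      (∀ (f : 𝒜.X ⟶ 𝒜.X) (g : 𝒞.X ⟶ 𝒞.X) [IsMonHom f] [IsMonHom g],
        baseChangeHom (baseChangeHom f _) x.left ≫ u = u ≫ baseChangeHom (baseChangeHom g _) x''.left →
        baseChangeHom (baseChangeHom f (pullback.fst 𝓨.total.hom (specResidueField v))) (𝓨.geomReductionMap x).left ≫ ubar =
          ubar ≫ baseChangeHom (baseChangeHom g (pullback.fst 𝓨.total.hom (specResidueField v))) (𝓨.geomReductionMap x'').left) ∧
      -- (iii) identities of section values transfer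
      (∀ (τ : 𝒜.Sections) (τ'' : 𝒞.Sections),
        AlgPoints.map u ((𝒜.baseChange _).restrictPt x.left (𝒜.sectionBaseChange _ τ)) =
          (𝒞.baseChange _).restrictPt x''.left (𝒞.sectionBaseChange _ τ'') →
        AlgPoints.map ubar ((𝒜.baseChange (pullback.fst 𝓨.total.hom (specResidueField v))).restrictPt (𝓨.geomReductionMap x).left
            (𝒜.sectionBaseChange _ τ)) =
          (𝒞.baseChange (pullback.fst 𝓨.total.hom (specResidueField v))).restrictPt (𝓨.geomReductionMap x'').left (𝒞.sectionBaseChange _ τ'')) ∧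
      -- (iv) a polarisation law in dual-homomorphism form transfers
      (∀ (D𝒜 : 𝒜.DualPair) (pol𝒜 : 𝒜.Polarization D𝒜) (D𝒞 : 𝒞.DualPair) (pol𝒞 : 𝒞.Polarization D𝒞) (n : ℕ),
        u ≫ ((pol𝒞.baseChange _).baseChange x''.left).lam ≫ DualPair.dualIsogenyOver u ((D𝒜.baseChange _).baseChange x.left) ((D𝒞.baseChange _).baseChange x''.left) =
          ((pol𝒜.baseChange _).baseChange x.left).lam ≫ ((D𝒜.baseChange _).baseChange x.left).hat.mulN n →
        ubar ≫ ((pol𝒞.baseChange (pullback.fst 𝓨.total.hom (specResidueField v))).baseChange (𝓨.geomReductionMap x'').left).lam ≫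
            DualPair.dualIsogenyOver ubar ((D𝒜.baseChange (pullback.fst 𝓨.total.hom (specResidueField v))).baseChange (𝓨.geomReductionMap x).left)
              ((D𝒞.baseChange (pullback.fst 𝓨.total.hom (specResidueField v))).baseChange (𝓨.geomReductionMap x'').left) =
          ((pol𝒜.baseChange (pullback.fst 𝓨.total.hom (specResidueField v))).baseChange (𝓨.geomReductionMap x).left).lam ≫
            ((D𝒜.baseChange (pullback.fst 𝓨.total.hom (specResidueField v))).baseChange (𝓨.geomReductionMap x).left).hat.mulN n) ∧
      -- (iv-h) the polarisation law of a POST-COMPOSITE `u ≫ h_{x″}` with a MODEL homomorphism `h : 𝒞 → ℰ` transfers to `ū ≫ h_{x̄″}` (this file)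
      (∀ (ℰ : AbelianSchemeOver 𝓨.total.left) (h : 𝒞.X ⟶ ℰ.X) [IsMonHom h]
        (u₂ : ((𝒜.baseChange (𝓨.genericIso'.inv.left ≫ pullback.fst 𝓨.total.hom (specGenericPoint (valuationSubringAtPrime K v) K))).baseChange x.left).X ⟶
          ((ℰ.baseChange (𝓨.genericIso'.inv.left ≫ pullback.fst 𝓨.total.hom (specGenericPoint (valuationSubringAtPrime K v) K))).baseChange x''.left).X) [IsMonHom u₂],
        u₂ = u ≫ baseChangeHom (baseChangeHom h (𝓨.genericIso'.inv.left ≫ pullback.fst 𝓨.total.hom (specGenericPoint (valuationSubringAtPrime K v) K))) x''.left →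
        ∀ (D𝒜 : 𝒜.DualPair) (pol𝒜 : 𝒜.Polarization D𝒜) (Dℰ : ℰ.DualPair) (polℰ : ℰ.Polarization Dℰ) (n : ℕ),
        u₂ ≫ ((polℰ.baseChange (𝓨.genericIso'.inv.left ≫ pullback.fst 𝓨.total.hom (specGenericPoint (valuationSubringAtPrime K v) K))).baseChange x''.left).lam ≫
            DualPair.dualIsogenyOver u₂ ((D𝒜.baseChange (𝓨.genericIso'.inv.left ≫ pullback.fst 𝓨.total.hom (specGenericPoint (valuationSubringAtPrime K v) K))).baseChange x.left) ((Dℰ.baseChange (𝓨.genericIso'.inv.left ≫ pullback.fst 𝓨.total.hom (specGenericPoint (valuationSubringAtPrime K v) K))).baseChange x''.left) =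
          ((pol𝒜.baseChange (𝓨.genericIso'.inv.left ≫ pullback.fst 𝓨.total.hom (specGenericPoint (valuationSubringAtPrime K v) K))).baseChange x.left).lam ≫ ((D𝒜.baseChange (𝓨.genericIso'.inv.left ≫ pullback.fst 𝓨.total.hom (specGenericPoint (valuationSubringAtPrime K v) K))).baseChange x.left).hat.mulN n →
        ∀ (w : ((𝒜.baseChange (pullback.fst 𝓨.total.hom (specResidueField v))).baseChange (𝓨.geomReductionMap x).left).X ⟶
          ((ℰ.baseChange (pullback.fst 𝓨.total.hom (specResidueField v))).baseChange (𝓨.geomReductionMap x'').left).X) [IsMonHom w],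
        w = ubar ≫ baseChangeHom (baseChangeHom h (pullback.fst 𝓨.total.hom (specResidueField v))) (𝓨.geomReductionMap x'').left →
        w ≫ ((polℰ.baseChange (pullback.fst 𝓨.total.hom (specResidueField v))).baseChange (𝓨.geomReductionMap x'').left).lam ≫
            DualPair.dualIsogenyOver w ((D𝒜.baseChange (pullback.fst 𝓨.total.hom (specResidueField v))).baseChange (𝓨.geomReductionMap x).left) ((Dℰ.baseChange (pullback.fst 𝓨.total.hom (specResidueField v))).baseChange (𝓨.geomReductionMap x'').left) =
          ((pol𝒜.baseChange (pullback.fst 𝓨.total.hom (specResidueField v))).baseChange (𝓨.geomReductionMap x).left).lam ≫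
            ((D𝒜.baseChange (pullback.fst 𝓨.total.hom (specResidueField v))).baseChange (𝓨.geomReductionMap x).left).hat.mulN n) ∧
      -- (v-b-model) [★ (ν8R)] KILL along a flat `𝒦 ↪ 𝒜_x̃` over the valuation ring `R = 𝒪_Ω̄` of the point (`x̃` the `R`-point extending `x`): if `𝒦_η`, read in `(𝒜_η)_x` through the
      -- three-piece isomorphism of ★ (d5), is killed by `u`, then `𝒦_s`, read in `(𝒜_s)_x̄`, is killed by `ū`
      (∀ (𝒦 : Over (Spec (.of (closureValuationSubring (v.adicCompletion K))))) (incl : 𝒦 ⟶ (𝒜.baseChange (extendPoint (closureValuationSubring (v.adicCompletion K)) (toClosureValuationSubring v) 𝓨.total (𝓨.modelPointsEquiv.symm x)).left).X) [Flat 𝒦.hom],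
        ((Over.pullback (specFractionFieldι (closureValuationSubring (v.adicCompletion K)) (toClosureValuationSubring v)).left).map incl ≫
            (𝒜.fibreBaseChangeIso (𝓨.genericIso'.inv.left ≫ pullback.fst 𝓨.total.hom (specGenericPoint (valuationSubringAtPrime K v) K)) x.left ≪≫ 𝒜.fibreCongrPtIso (𝓨.left_specFractionFieldι_comp_extendPoint_modelPointsEquiv_symm x).symm ≪≫ (𝒜.fibreBaseChangeIso (extendPoint (closureValuationSubring (v.adicCompletion K)) (toClosureValuationSubring v) 𝓨.total (𝓨.modelPointsEquiv.symm x)).left (specFractionFieldι (closureValuationSubring (v.adicCompletion K)) (toClosureValuationSubring v)).left).symm).inv.hom.hom.hom) ≫ u = 1 →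
        ((Over.pullback ((geomClosedPointIsoSpecResidueField v).inv.left ≫ (specRingHomι (closureValuationSubring (v.adicCompletion K)) (toClosureValuationSubring v) (IsLocalRing.residue (closureValuationSubring (v.adicCompletion K)))).left)).map incl ≫
            (𝒜.fibreBaseChangeIso (pullback.fst 𝓨.total.hom (specResidueField v)) (𝓨.geomReductionMap x).left ≪≫ 𝒜.fibreCongrPtIso ((𝓨.left_geomReductionMap_comp_fst x).trans (Category.assoc _ _ _).symm) ≪≫ (𝒜.fibreBaseChangeIso (extendPoint (closureValuationSubring (v.adicCompletion K)) (toClosureValuationSubring v) 𝓨.total (𝓨.modelPointsEquiv.symm x)).left ((geomClosedPointIsoSpecResidueField v).inv.left ≫ (specRingHomι (closureValuationSubring (v.adicCompletion K)) (toClosureValuationSubring v) (IsLocalRing.residue (closureValuationSubring (v.adicCompletion K)))).left)).symm).inv.hom.hom.hom) ≫ ubar = 1) ∧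
      -- (v-a-model) [★ (ν8R)] the kernel CLAUSE along a flat closed `𝒦 ↪ 𝒜_x̃`, for `u` finite surjective: `𝒦_η = Ker u` on `T`-points ⇒ `𝒦_s = Ker ū` on `T`-points
      (∀ (𝒦 : Over (Spec (.of (closureValuationSubring (v.adicCompletion K))))) (incl : 𝒦 ⟶ (𝒜.baseChange (extendPoint (closureValuationSubring (v.adicCompletion K)) (toClosureValuationSubring v) 𝓨.total (𝓨.modelPointsEquiv.symm x)).left).X) [Flat 𝒦.hom] [IsClosedImmersion incl.left],
        IsFinite u.left → Surjective u.left →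
        (∀ ⦃W : Over (Spec (.of (AlgebraicClosure (v.adicCompletion K))))⦄ (t : W ⟶ ((𝒜.baseChange (extendPoint (closureValuationSubring (v.adicCompletion K)) (toClosureValuationSubring v) 𝓨.total (𝓨.modelPointsEquiv.symm x)).left).baseChange (specFractionFieldι (closureValuationSubring (v.adicCompletion K)) (toClosureValuationSubring v)).left).X),
          (∃ s : W ⟶ (Over.pullback (specFractionFieldι (closureValuationSubring (v.adicCompletion K)) (toClosureValuationSubring v)).left).obj 𝒦, s ≫ (Over.pullback (specFractionFieldι (closureValuationSubring (v.adicCompletion K)) (toClosureValuationSubring v)).left).map incl = t) ↔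
            (t ≫ (𝒜.fibreBaseChangeIso (𝓨.genericIso'.inv.left ≫ pullback.fst 𝓨.total.hom (specGenericPoint (valuationSubringAtPrime K v) K)) x.left ≪≫ 𝒜.fibreCongrPtIso (𝓨.left_specFractionFieldι_comp_extendPoint_modelPointsEquiv_symm x).symm ≪≫ (𝒜.fibreBaseChangeIso (extendPoint (closureValuationSubring (v.adicCompletion K)) (toClosureValuationSubring v) 𝓨.total (𝓨.modelPointsEquiv.symm x)).left (specFractionFieldι (closureValuationSubring (v.adicCompletion K)) (toClosureValuationSubring v)).left).symm).inv.hom.hom.hom) ≫ u = 1) →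
        ∀ ⦃W : Over (Spec (.of (geomResidueField v)))⦄ (t : W ⟶ ((𝒜.baseChange (extendPoint (closureValuationSubring (v.adicCompletion K)) (toClosureValuationSubring v) 𝓨.total (𝓨.modelPointsEquiv.symm x)).left).baseChange ((geomClosedPointIsoSpecResidueField v).inv.left ≫ (specRingHomι (closureValuationSubring (v.adicCompletion K)) (toClosureValuationSubring v) (IsLocalRing.residue (closureValuationSubring (v.adicCompletion K)))).left)).X),
          (∃ s : W ⟶ (Over.pullback ((geomClosedPointIsoSpecResidueField v).inv.left ≫ (specRingHomι (closureValuationSubring (v.adicCompletion K)) (toClosureValuationSubring v) (IsLocalRing.residue (closureValuationSubring (v.adicCompletion K)))).left)).obj 𝒦, s ≫ (Over.pullback ((geomClosedPointIsoSpecResidueField v).inv.left ≫ (specRingHomι (closureValuationSubring (v.adicCompletion K)) (toClosureValuationSubring v) (IsLocalRing.residue (closureValuationSubring (v.adicCompletion K)))).left)).map incl = t) ↔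
            (t ≫ (𝒜.fibreBaseChangeIso (pullback.fst 𝓨.total.hom (specResidueField v)) (𝓨.geomReductionMap x).left ≪≫ 𝒜.fibreCongrPtIso ((𝓨.left_geomReductionMap_comp_fst x).trans (Category.assoc _ _ _).symm) ≪≫ (𝒜.fibreBaseChangeIso (extendPoint (closureValuationSubring (v.adicCompletion K)) (toClosureValuationSubring v) 𝓨.total (𝓨.modelPointsEquiv.symm x)).left ((geomClosedPointIsoSpecResidueField v).inv.left ≫ (specRingHomι (closureValuationSubring (v.adicCompletion K)) (toClosureValuationSubring v) (IsLocalRing.residue (closureValuationSubring (v.adicCompletion K)))).left)).symm).inv.hom.hom.hom) ≫ ubar = 1) ∧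
      -- (K2) [★ (ν8k-b)] a ONE-SIDED kernel bound `Ker u ⊆ 𝒜_x[𝔞]` on all `T`-points transfers to `Ker ū ⊆ 𝒜_{x̄}[𝔞]` on ALL `T`-points, for every ideal `𝔞` (★ `AbelianSchemeHomReductionSpecialFibreKernelBound` §2)
      (IsFinite u.left → Surjective u.left → ∀ 𝔞 : Ideal O,
        (∀ ⦃T : Over (Spec (.of (AlgebraicClosure (v.adicCompletion K))))⦄ (t : T ⟶ ((𝒜.baseChange (𝓨.genericIso'.inv.left ≫ pullback.fst 𝓨.total.hom (specGenericPoint (valuationSubringAtPrime K v) K))).baseChange x.left).X),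
          t ≫ u = 1 → ∀ r ∈ 𝔞, t ≫ ((act.baseChange (𝓨.genericIso'.inv.left ≫ pullback.fst 𝓨.total.hom (specGenericPoint (valuationSubringAtPrime K v) K))).baseChange x.left).i r = 1) →
        ∀ ⦃T : Over (Spec (.of (geomResidueField v)))⦄ (t : T ⟶ ((𝒜.baseChange (pullback.fst 𝓨.total.hom (specResidueField v))).baseChange (𝓨.geomReductionMap x).left).X),
          t ≫ ubar = 1 → ∀ r ∈ 𝔞, t ≫ ((act.baseChange (pullback.fst 𝓨.total.hom (specResidueField v))).baseChange (𝓨.geomReductionMap x).left).i r = 1) := by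
  -- the homomorphism of abelian varieties underlying `u`, and the TURNKEY reduction ★ (ν7)
  obtain ⟨D, _i1, _i2, L, _i3, _i4, _i5, _i6, _i7, _i8, gD, h, hh, hgD, ha, z, z'', hz, hz'', L', _j1, _j2, _j3, _j4, _j5, χ, h', U, hU,
      hpt, hpt'', e, hspt, hspt'', et, hχ, hh', hh'h, hDed, hFrac, hfib, huniq, hisog⟩ :=
    exists_stage_hom_reduction_turnkey 𝓨 𝒜 𝒞 x x'' (homOfIsMonHom u)
  haveI := hDed
  haveI := hFrac
  haveI := hU
  -- injectivity of restriction to the `Ω`-point `ξ′` of the refined stage (schematically dominant: `D′ → Ω` injective)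
  have h'inj : Function.Injective h' := by
    intro a b hab
    have h1 : χ (a : L') = χ (b : L') := by rw [← hh', ← hh', hab]
    exact Subtype.ext (hχ h1)
  haveI : IsDominant (specGenericPoint (closureValuationSubring (v.adicCompletion K)) (AlgebraicClosure (v.adicCompletion K)) ≫ Spec.map (CommRingCat.ofHom h')) := by
    haveI := isDominant_specMap_of_injective
      (algebraMap (closureValuationSubring (v.adicCompletion K)) (AlgebraicClosure (v.adicCompletion K))) Subtype.val_injective
    haveI := isDominant_specMap_of_injective h' h'inj
    infer_instance
  haveI : IsSchemeTheoreticallyDominant (specGenericPoint (closureValuationSubring (v.adicCompletion K)) (AlgebraicClosure (v.adicCompletion K)) ≫ Spec.map (CommRingCat.ofHom h')) := IsSchemeTheoreticallyDominant.of_isDominant _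
  -- the refined stage `Spec D′` is connected, reduced, Noetherian (Dedekind); the generic point of the valuation ring `R` is schematically dominant
  haveI : IsNoetherianRing (integralClosure D L') := inferInstance
  haveI : QuasiCompact (specFractionFieldι (closureValuationSubring (v.adicCompletion K)) (toClosureValuationSubring v)).left :=
    inferInstanceAs (QuasiCompact (Spec.map (CommRingCat.ofHom (algebraMap (closureValuationSubring (v.adicCompletion K)) (AlgebraicClosure (v.adicCompletion K))))))
  haveI : IsSchemeTheoreticallyDominant (specFractionFieldι (closureValuationSubring (v.adicCompletion K)) (toClosureValuationSubring v)).left :=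
    Literature.AlgebraicGeometry.Limits.isSchemeTheoreticallyDominant_specMap_of_injective
      (algebraMap (closureValuationSubring (v.adicCompletion K)) (AlgebraicClosure (v.adicCompletion K))) Subtype.val_injective
  -- the `R`-point `x̃` factors through the refined stage: `x̃ = Spec h′ ≫ Spec (D → D′) ≫ z`
  have hxR : (extendPoint (closureValuationSubring (v.adicCompletion K)) (toClosureValuationSubring v) 𝓨.total (𝓨.modelPointsEquiv.symm x)).left = (Spec.map (CommRingCat.ofHom h') ≫ (Spec.map (CommRingCat.ofHom (algebraMap D (integralClosure D L'))))) ≫ z.left := by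
    rw [← hz, ← hh'h, CommRingCat.ofHom_comp, Spec.map_comp]
  -- ALL SIX TRANSFERS AT ONCE (★ (ν8R) `specialFibre_transfers_of_generic_model` at the turnkey's stage and the `R`-model `𝒜_x̃`)
  have H := specialFibre_transfers_of_generic_model (𝓨.genericIso'.inv.left ≫ pullback.fst 𝓨.total.hom (specGenericPoint (valuationSubringAtPrime K v) K)) z.left z''.left (Spec.map (CommRingCat.ofHom (algebraMap D (integralClosure D L')))) x.left x''.left (specGenericPoint (closureValuationSubring (v.adicCompletion K)) (AlgebraicClosure (v.adicCompletion K)) ≫ Spec.map (CommRingCat.ofHom h)) (specGenericPoint (closureValuationSubring (v.adicCompletion K)) (AlgebraicClosure (v.adicCompletion K)) ≫ Spec.map (CommRingCat.ofHom h')) hpt hpt'' e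
    (pullback.fst 𝓨.total.hom (specResidueField v)) (𝓨.geomReductionMap x).left (𝓨.geomReductionMap x'').left (((geomClosedPointIsoSpecResidueField v).inv.left ≫ (specRingHomι (closureValuationSubring (v.adicCompletion K)) (toClosureValuationSubring v) (IsLocalRing.residue (closureValuationSubring (v.adicCompletion K)))).left) ≫ Spec.map (CommRingCat.ofHom h)) (((geomClosedPointIsoSpecResidueField v).inv.left ≫ (specRingHomι (closureValuationSubring (v.adicCompletion K)) (toClosureValuationSubring v) (IsLocalRing.residue (closureValuationSubring (v.adicCompletion K)))).left) ≫ Spec.map (CommRingCat.ofHom h')) hspt hspt'' et 𝒜 𝒞 U u hfib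
    (Spec.map (CommRingCat.ofHom h')) (extendPoint (closureValuationSubring (v.adicCompletion K)) (toClosureValuationSubring v) 𝓨.total (𝓨.modelPointsEquiv.symm x)).left hxR (specFractionFieldι (closureValuationSubring (v.adicCompletion K)) (toClosureValuationSubring v)).left ((geomClosedPointIsoSpecResidueField v).inv.left ≫ (specRingHomι (closureValuationSubring (v.adicCompletion K)) (toClosureValuationSubring v) (IsLocalRing.residue (closureValuationSubring (v.adicCompletion K)))).left) rfl rfl
    (𝓨.left_specFractionFieldι_comp_extendPoint_modelPointsEquiv_symm x).symm ((𝓨.left_geomReductionMap_comp_fst x).trans (Category.assoc _ _ _).symm)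
  refine ⟨_, H.fst, fun hfin hsurj => H.snd.1 (hisog ⟨hsurj, hfin⟩ _), H.snd.2.1, H.snd.2.2.1, H.snd.2.2.2.1, ?_,
    fun 𝒦 incl _ hk => H.snd.2.2.2.2.1 𝒦 incl hk,
    fun 𝒦 incl _ _ hfin hsurj hc W t =>
      H.snd.2.2.2.2.2 (flat_ker_hom L' U (hisog ⟨hsurj, hfin⟩ (specGenericPoint (integralClosure D L') L'))) 𝒦 incl hc t, ?_⟩
  · -- (iv-h) the post-composite (★ (ν8h) §1 `specialFibre_postcomp_comp_lam_comp_dualIsogenyOver_eq_of_generic`)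
    intro ℰ hm _ u₂ _ hu₂eq D𝒜 pol𝒜 Dℰ polℰ n hlam w _ hweq
    exact specialFibre_postcomp_comp_lam_comp_dualIsogenyOver_eq_of_generic (𝓨.genericIso'.inv.left ≫ pullback.fst 𝓨.total.hom (specGenericPoint (valuationSubringAtPrime K v) K)) z.left z''.left (Spec.map (CommRingCat.ofHom (algebraMap D (integralClosure D L')))) x.left x''.left (specGenericPoint (closureValuationSubring (v.adicCompletion K)) (AlgebraicClosure (v.adicCompletion K)) ≫ Spec.map (CommRingCat.ofHom h)) (specGenericPoint (closureValuationSubring (v.adicCompletion K)) (AlgebraicClosure (v.adicCompletion K)) ≫ Spec.map (CommRingCat.ofHom h')) hpt hpt'' e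
      (pullback.fst 𝓨.total.hom (specResidueField v)) (𝓨.geomReductionMap x).left (𝓨.geomReductionMap x'').left (((geomClosedPointIsoSpecResidueField v).inv.left ≫ (specRingHomι (closureValuationSubring (v.adicCompletion K)) (toClosureValuationSubring v) (IsLocalRing.residue (closureValuationSubring (v.adicCompletion K)))).left) ≫ Spec.map (CommRingCat.ofHom h)) (((geomClosedPointIsoSpecResidueField v).inv.left ≫ (specRingHomι (closureValuationSubring (v.adicCompletion K)) (toClosureValuationSubring v) (IsLocalRing.residue (closureValuationSubring (v.adicCompletion K)))).left) ≫ Spec.map (CommRingCat.ofHom h')) hspt hspt'' et 𝒜 𝒞 U u hfib ℰ hm D𝒜 pol𝒜 Dℰ polℰ n u₂ hu₂eq hlam w hweq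
  · -- (K2) the one-sided kernel bound (★ (ν8k-b) §2 `comp_specialFibre_i_eq_one_of_generic`; `Ker U → Spec D′` is flat, ★ `flat_ker_hom`)
    intro hfin hsurj 𝔞 hle T t ht
    haveI : Flat (ker U).hom := flat_ker_hom L' U (hisog ⟨hsurj, hfin⟩ (specGenericPoint (integralClosure D L') L'))
    exact comp_specialFibre_i_eq_one_of_generic (𝓨.genericIso'.inv.left ≫ pullback.fst 𝓨.total.hom (specGenericPoint (valuationSubringAtPrime K v) K)) z.left z''.left (Spec.map (CommRingCat.ofHom (algebraMap D (integralClosure D L')))) x.left x''.left (specGenericPoint (closureValuationSubring (v.adicCompletion K)) (AlgebraicClosure (v.adicCompletion K)) ≫ Spec.map (CommRingCat.ofHom h)) (specGenericPoint (closureValuationSubring (v.adicCompletion K)) (AlgebraicClosure (v.adicCompletion K)) ≫ Spec.map (CommRingCat.ofHom h')) hpt hpt'' e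
      (pullback.fst 𝓨.total.hom (specResidueField v)) (𝓨.geomReductionMap x).left (𝓨.geomReductionMap x'').left (((geomClosedPointIsoSpecResidueField v).inv.left ≫ (specRingHomι (closureValuationSubring (v.adicCompletion K)) (toClosureValuationSubring v) (IsLocalRing.residue (closureValuationSubring (v.adicCompletion K)))).left) ≫ Spec.map (CommRingCat.ofHom h)) (((geomClosedPointIsoSpecResidueField v).inv.left ≫ (specRingHomι (closureValuationSubring (v.adicCompletion K)) (toClosureValuationSubring v) (IsLocalRing.residue (closureValuationSubring (v.adicCompletion K)))).left) ≫ Spec.map (CommRingCat.ofHom h')) hspt hspt'' et 𝒜 𝒞 U u hfib act 𝔞 hle t ht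

end Head

end AbelianSchemeOver

end Literature.AlgebraicGeometry.AbelianSchemes

end
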